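import Literature.Analysis.FunctionSpaces.SmoothParametricIntegral
import Summits.FinalStateConjecture.FinalStateConjecture.Theorems.PhotonSphereChannelsEnergyIdentity

/-!
# Route PhotonSphereChannels — the Duhamel operator of the 1+1 wave equation (towards well-posedness)

First file of the existence theory for `ψ_tt − ψ_xx + V ψ = 0` with smooth data, the missing
formal ingredient (i) for any Lean refutation of `UniformPhotonSphereChannels`
(item stmt-FinalStateConjecture-10045, see the cdisprove list in `Cruxes/…/Disproof.lean`) and for
the existence statement `BlindnessInsidePhotonSphere`: the three linear items of the route quantify
over / ask for `C²` solutions `ψ : ℝ → ℝ → ℝ`, and no solution other than `0` can be written down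
without a solution operator.  Contents (smooth category, `F : ℝ × ℝ → ℝ` smooth, `z = (t, x)`):

* `contDiff_parametric_primitive`: `(τ, q) ↦ ∫ s in 0..τ, h (s, q)` is smooth for smooth `h`
  (the `θ`-trick `∫₀^τ h = ∫₀¹ τ h(τθ) dθ` + the tree's
  `Literature.Analysis.FunctionSpaces.contDiff_parametric_intervalIntegral`), with its partials
  (`fderiv_parametric_primitive`: FTC in `τ`, differentiation under the integral sign in `q`);
* the **Leibniz rule** for `K (p) = ∫ s in 0..p.1, J (s, p)` (`contDiff_leibniz`, `fderiv_leibniz`: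
  `∂K(p)(v) = v₁ J(p₁, p) + ∫₀^{p₁} ∂J(s,p)(0,v) ds`);
* the **Duhamel operator** `D (t, x) = ½ ∫ s in 0..t, (Φ (s, x+(t−s)) − Φ (s, x−(t−s)))`,
  `Φ (s, ·)` the primitive of `F (s, ·)` — i.e. `½ ∫₀ᵗ ∫_{x−(t−s)}^{x+(t−s)} F` with ORIENTED
  integrals, valid for all real `t` —: it is smooth (`contDiff_duhamel`), its first partials are the
  characteristic integrals `∂D(t,x)(v) = ½ ∫₀ᵗ (F(s,x+(t−s))(v₁+v₂) + F(s,x−(t−s))(v₁−v₂)) ds`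
  (`fderiv_duhamel`), and it solves the inhomogeneous wave equation with zero data:
  `D_tt − D_xx = F`, `D(0,·) = 0`, `D_t(0,·) = 0` (`duhamel_wave_eq`, `duhamel_zero`,
  `fderiv_duhamel_zero`; second partials in the Fréchet form of the energy-calculus files).

Functions given by formulas are passed with defining hypotheses; no definitions. [folklore]
-/

namespace Summit.FinalStateConjecture.FinalStateConjecture.Theorems

open MeasureTheory Set Filter Topology intervalIntegral
open scoped ContDiff

noncomputable section

namespace WaveEnergy

/-! ### Smooth parametric primitives and the Leibniz rule -/

section Primitive

variable {Q : Type*} [NormedAddCommGroup Q] [NormedSpace ℝ Q] [FiniteDimensional ℝ Q]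

/-- The `θ`-trick: `∫ s in 0..τ, h s = ∫ θ in 0..1, τ • h (τ * θ)`. -/
theorem intervalIntegral_eq_integral_unit (h : ℝ → ℝ) (τ : ℝ) :
    (∫ s in (0 : ℝ)..τ, h s) = ∫ θ in (0 : ℝ)..1, τ * h (τ * θ) := by
  rw [intervalIntegral.integral_const_mul, ← smul_eq_mul,
    intervalIntegral.smul_integral_comp_mul_left, mul_zero, mul_one]

/-- **Smooth parametric primitive.** For a smooth `h : ℝ × Q → ℝ` (`Q` finite dimensional), the
primitive with variable upper limit `(τ, q) ↦ ∫ s in 0..τ, h (s, q)` is smooth on `ℝ × Q`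
(`θ`-trick + smooth dependence of fixed-limits parametric integrals,
`Literature.Analysis.FunctionSpaces.contDiff_parametric_intervalIntegral`). [folklore] -/
theorem contDiff_parametric_primitive {h : ℝ × Q → ℝ} (hh : ContDiff ℝ ∞ h) :
    ContDiff ℝ ∞ fun q : ℝ × Q => ∫ s in (0 : ℝ)..q.1, h (s, q.2) := by
  have heq : (fun q : ℝ × Q => ∫ s in (0 : ℝ)..q.1, h (s, q.2))
      = fun q : ℝ × Q => ∫ θ in (0 : ℝ)..1, q.1 * h (q.1 * θ, q.2) := by
    funext q
    exact intervalIntegral_eq_integral_unit (fun s => h (s, q.2)) q.1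
  rw [heq]
  refine Literature.Analysis.FunctionSpaces.contDiff_parametric_intervalIntegral
    (H := fun r : ℝ × (ℝ × Q) => r.2.1 * h (r.2.1 * r.1, r.2.2)) ?_ 0 1
  have h1 : ContDiff ℝ ∞ fun r : ℝ × (ℝ × Q) => (r.2.1 * r.1, r.2.2) := by fun_prop
  exact (contDiff_fst.comp contDiff_snd).mul (hh.comp h1)

omit [FiniteDimensional ℝ Q] in
/-- Slices in the first (real) variable: `τ ↦ Ψ (τ, q)` has derivative `∂Ψ(τ,q)(1,0)`. -/
theorem hasDerivAt_slice_fst' {Ψ : ℝ × Q → ℝ} (hΨ : Differentiable ℝ Ψ) (τ : ℝ) (q : Q) :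
    HasDerivAt (fun σ => Ψ (σ, q)) (fderiv ℝ Ψ (τ, q) (1, 0)) τ := by
  have h1 : HasDerivAt (fun σ : ℝ => (σ, q)) ((1 : ℝ), (0 : Q)) τ :=
    (hasDerivAt_id τ).prodMk (hasDerivAt_const τ q)
  exact (hΨ (τ, q)).hasFDerivAt.comp_hasDerivAt τ h1

omit [FiniteDimensional ℝ Q] in
/-- Slices in the second variable: `q ↦ Ψ (τ, q)` has derivative `∂Ψ(τ,q) ∘ (0, ·)`. -/
theorem hasFDerivAt_slice_snd' {Ψ : ℝ × Q → ℝ} (hΨ : Differentiable ℝ Ψ) (τ : ℝ) (q : Q) :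
    HasFDerivAt (fun p => Ψ (τ, p)) ((fderiv ℝ Ψ (τ, q)).comp (ContinuousLinearMap.inr ℝ ℝ Q)) q := by
  have h1 : HasFDerivAt (fun p : Q => ((τ, p) : ℝ × Q)) (ContinuousLinearMap.inr ℝ ℝ Q) q :=
    (hasFDerivAt_const τ q).prodMk (hasFDerivAt_id q)
  exact (hΨ (τ, q)).hasFDerivAt.comp q h1

/-- **Partials of the smooth parametric primitive.** With `Ψ (τ, q) = ∫ s in 0..τ, h (s, q)`:
`∂Ψ(τ,q)(1,0) = h (τ, q)` (FTC) and `∂Ψ(τ,q)(0,v) = ∫ s in 0..τ, ∂h(s,q)(0,v)`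
(one derivative under the integral sign). -/
theorem fderiv_parametric_primitive {h : ℝ × Q → ℝ} (hh : ContDiff ℝ ∞ h) (τ : ℝ) (q : Q) (a : ℝ)
    (v : Q) :
    fderiv ℝ (fun q : ℝ × Q => ∫ s in (0 : ℝ)..q.1, h (s, q.2)) (τ, q) (a, v)
      = a * h (τ, q) + ∫ s in (0 : ℝ)..τ, fderiv ℝ h (s, q) ((0 : ℝ), v) := by
  set Ψ : ℝ × Q → ℝ := fun q => ∫ s in (0 : ℝ)..q.1, h (s, q.2) with hΨ
  have hΨd : Differentiable ℝ Ψ := (contDiff_parametric_primitive hh).differentiable (by simp)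
  have hsplit : ((a, v) : ℝ × Q) = a • ((1 : ℝ), (0 : Q)) + ((0 : ℝ), v) := by ext <;> simp
  rw [hsplit, map_add, map_smul, smul_eq_mul]
  congr 1
  · -- `∂_τ Ψ = h` by the fundamental theorem of calculus
    have hc : Continuous fun s => h (s, q) := hh.continuous.comp (Continuous.prodMk_left q)
    have hftc : HasDerivAt (fun σ => Ψ (σ, q)) (h (τ, q)) τ := by
      simp only [hΨ]
      exact intervalIntegral.integral_hasDerivAt_right (hc.intervalIntegrable _ _)
        hc.aestronglyMeasurable.stronglyMeasurableAtFilter hc.continuousAt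
    rw [(hasDerivAt_slice_fst' hΨd τ q).unique hftc]
  · -- `∂_q Ψ = ∫ ∂_q h` by differentiation under the integral sign
    have h1 : fderiv ℝ Ψ (τ, q) ((0 : ℝ), v) = fderiv ℝ (fun p => Ψ (τ, p)) q v := by
      rw [(hasFDerivAt_slice_snd' hΨd τ q).fderiv]
      rfl
    rw [h1]
    simp only [hΨ]
    exact Literature.Analysis.FunctionSpaces.fderiv_parametric_intervalIntegral_apply
      (H := h) hh (by simp) 0 τ q v

/-- **Leibniz rule for `K p = ∫ s in 0..p.1, J (s, p)`** (`J : ℝ × (ℝ × Q') → ℝ` smooth, here with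
`Q' = ℝ`, i.e. parameters `p = (t, x)`): `K` is smooth and
`∂K(p)(v) = v.1 · J (p.1, p) + ∫ s in 0..p.1, ∂J(s,p)(0,v)`. [folklore] -/
theorem contDiff_leibniz {J : ℝ × (ℝ × ℝ) → ℝ} (hJ : ContDiff ℝ ∞ J) :
    ContDiff ℝ ∞ fun p : ℝ × ℝ => ∫ s in (0 : ℝ)..p.1, J (s, p) := by
  have hΨ := contDiff_parametric_primitive (Q := ℝ × ℝ) hJ
  exact hΨ.comp (contDiff_fst.prodMk contDiff_id)

/-- The Leibniz formula for `∂K(p)(v)`, see `contDiff_leibniz`. -/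
theorem fderiv_leibniz {J : ℝ × (ℝ × ℝ) → ℝ} (hJ : ContDiff ℝ ∞ J) (p v : ℝ × ℝ) :
    fderiv ℝ (fun p : ℝ × ℝ => ∫ s in (0 : ℝ)..p.1, J (s, p)) p v
      = v.1 * J (p.1, p) + ∫ s in (0 : ℝ)..p.1, fderiv ℝ J (s, p) ((0 : ℝ), v) := by
  set Ψ : ℝ × (ℝ × ℝ) → ℝ := fun q => ∫ s in (0 : ℝ)..q.1, J (s, q.2) with hΨ
  have hΨs : ContDiff ℝ ∞ Ψ := contDiff_parametric_primitive (Q := ℝ × ℝ) hJ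
  have hA : HasFDerivAt (fun p : ℝ × ℝ => ((p.1, p) : ℝ × (ℝ × ℝ)))
      ((ContinuousLinearMap.fst ℝ ℝ ℝ).prod (ContinuousLinearMap.id ℝ (ℝ × ℝ))) p :=
    (hasFDerivAt_fst).prodMk (hasFDerivAt_id p)
  have hcomp : HasFDerivAt (Ψ ∘ fun p : ℝ × ℝ => ((p.1, p) : ℝ × (ℝ × ℝ)))
      ((fderiv ℝ Ψ (p.1, p)).comp
        ((ContinuousLinearMap.fst ℝ ℝ ℝ).prod (ContinuousLinearMap.id ℝ (ℝ × ℝ)))) p :=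
    HasFDerivAt.comp p ((hΨs.differentiable (by simp)) (p.1, p)).hasFDerivAt hA
  have heq : (fun p : ℝ × ℝ => ∫ s in (0 : ℝ)..p.1, J (s, p))
      = Ψ ∘ fun p : ℝ × ℝ => ((p.1, p) : ℝ × (ℝ × ℝ)) := by
    funext p; simp [hΨ]
  rw [heq, hcomp.fderiv]
  simp only [ContinuousLinearMap.coe_comp, Function.comp_apply, ContinuousLinearMap.prod_apply,
    ContinuousLinearMap.coe_fst', ContinuousLinearMap.coe_id', id_eq]
  exact fderiv_parametric_primitive (Q := ℝ × ℝ) hJ p.1 p v.1 v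

end Primitive

/-! ### The Duhamel operator `D F (t,x) = ½ ∫₀ᵗ ∫_{x-(t-s)}^{x+(t-s)} F(s,y) dy ds` -/

section DuhamelOp

variable {F Φ D : ℝ × ℝ → ℝ}

/-- The parametric primitive `Φ (s, z) = ∫ y in 0..z, F (s, y)` of a smooth `F` is smooth. -/
theorem contDiff_primitive_snd (hF : ContDiff ℝ ∞ F) (hΦ : ∀ s z, Φ (s, z) = ∫ y in (0 : ℝ)..z, F (s, y)) :
    ContDiff ℝ ∞ Φ := by
  have h1 := contDiff_parametric_primitive (Q := ℝ) (h := fun q : ℝ × ℝ => F (q.2, q.1))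
    (hF.comp (contDiff_snd.prodMk contDiff_fst))
  have heq : Φ = (fun q : ℝ × ℝ => ∫ s in (0 : ℝ)..q.1, F (q.2, s)) ∘ fun q : ℝ × ℝ => (q.2, q.1) := by
    funext q
    simp [hΦ q.1 q.2]
  rw [heq]
  exact h1.comp (contDiff_snd.prodMk contDiff_fst)

/-- `z ↦ Φ (s, z)` has derivative `F (s, z)` (fundamental theorem of calculus). -/
theorem hasDerivAt_primitive_snd (hF : ContDiff ℝ ∞ F)
    (hΦ : ∀ s z, Φ (s, z) = ∫ y in (0 : ℝ)..z, F (s, y)) (s z : ℝ) :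
    HasDerivAt (fun ζ => Φ (s, ζ)) (F (s, z)) z := by
  have hc : Continuous fun y => F (s, y) := hF.continuous.comp (Continuous.prodMk_right s)
  have hfun : (fun ζ => Φ (s, ζ)) = fun ζ => ∫ y in (0 : ℝ)..ζ, F (s, y) := funext fun ζ => hΦ s ζ
  rw [hfun]
  exact intervalIntegral.integral_hasDerivAt_right (hc.intervalIntegrable _ _)
    hc.aestronglyMeasurable.stronglyMeasurableAtFilter hc.continuousAt

/-- Derivative of `p = (t, x) ↦ Φ (s, x + c (t − s))` (`c = ±1`): `F (s, x + c (t−s)) · (c v₁ + v₂)`. -/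
theorem hasFDerivAt_primitive_comp_affine (hF : ContDiff ℝ ∞ F)
    (hΦ : ∀ s z, Φ (s, z) = ∫ y in (0 : ℝ)..z, F (s, y)) (s c : ℝ) (p : ℝ × ℝ) :
    HasFDerivAt (fun q : ℝ × ℝ => Φ (s, q.2 + c * (q.1 - s)))
      (F (s, p.2 + c * (p.1 - s)) • (ContinuousLinearMap.snd ℝ ℝ ℝ + c • ContinuousLinearMap.fst ℝ ℝ ℝ))
      p := by
  have hg : HasFDerivAt (fun q : ℝ × ℝ => q.2 + c * (q.1 - s))
      (ContinuousLinearMap.snd ℝ ℝ ℝ + c • ContinuousLinearMap.fst ℝ ℝ ℝ) p := by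
    have h := ((ContinuousLinearMap.snd ℝ ℝ ℝ + c • ContinuousLinearMap.fst ℝ ℝ ℝ).hasFDerivAt
      (x := p)).sub_const (c * s)
    refine h.congr_of_eventuallyEq (Eventually.of_forall fun q => ?_)
    simp only [add_apply, ContinuousLinearMap.coe_snd',
      smul_apply, ContinuousLinearMap.coe_fst', smul_eq_mul]
    ring
  exact (hasDerivAt_primitive_snd hF hΦ s (p.2 + c * (p.1 - s))).comp_hasFDerivAt p hg

/-- **The Duhamel operator is smooth.** For smooth `F`, `D (t, x) = ½ ∫ s in 0..t,
(Φ (s, x + (t − s)) − Φ (s, x − (t − s)))` with `Φ (s, ·)` the primitive of `F (s, ·)` is smooth on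
`ℝ × ℝ` (all real `t`: oriented integrals). [folklore] -/
theorem contDiff_duhamel (hF : ContDiff ℝ ∞ F) (hΦ : ∀ s z, Φ (s, z) = ∫ y in (0 : ℝ)..z, F (s, y))
    (hD : ∀ t x, D (t, x) = (1 / 2) * ∫ s in (0 : ℝ)..t, (Φ (s, x + (t - s)) - Φ (s, x - (t - s)))) :
    ContDiff ℝ ∞ D := by
  have hΦs := contDiff_primitive_snd hF hΦ
  have hJ : ContDiff ℝ ∞ fun r : ℝ × (ℝ × ℝ) =>
      Φ (r.1, r.2.2 + (r.2.1 - r.1)) - Φ (r.1, r.2.2 - (r.2.1 - r.1)) := by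
    refine (hΦs.comp ?_).sub (hΦs.comp ?_) <;> fun_prop
  have hK := contDiff_leibniz hJ
  have heq : D = fun p : ℝ × ℝ => (1 / 2 : ℝ) * ∫ s in (0 : ℝ)..p.1,
      (fun r : ℝ × (ℝ × ℝ) => Φ (r.1, r.2.2 + (r.2.1 - r.1)) - Φ (r.1, r.2.2 - (r.2.1 - r.1))) (s, p) := by
    funext p
    rw [show p = (p.1, p.2) from rfl, hD]
  rw [heq]
  exact contDiff_const.mul hK

/-- **First derivatives of the Duhamel operator**:
`∂D(t,x)(v) = ½ ∫ s in 0..t, (F (s, x+(t−s)) (v₁ + v₂) + F (s, x−(t−s)) (v₁ − v₂))`. -/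
theorem fderiv_duhamel (hF : ContDiff ℝ ∞ F) (hΦ : ∀ s z, Φ (s, z) = ∫ y in (0 : ℝ)..z, F (s, y))
    (hD : ∀ t x, D (t, x) = (1 / 2) * ∫ s in (0 : ℝ)..t, (Φ (s, x + (t - s)) - Φ (s, x - (t - s))))
    (t x : ℝ) (v : ℝ × ℝ) :
    fderiv ℝ D (t, x) v = (1 / 2) * ∫ s in (0 : ℝ)..t,
      (F (s, x + (t - s)) * (v.1 + v.2) + F (s, x - (t - s)) * (v.1 - v.2)) := by
  have hΦs := contDiff_primitive_snd hF hΦ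
  set J : ℝ × (ℝ × ℝ) → ℝ := fun r =>
    Φ (r.1, r.2.2 + (r.2.1 - r.1)) - Φ (r.1, r.2.2 - (r.2.1 - r.1)) with hJdef
  have hJ : ContDiff ℝ ∞ J := by
    refine (hΦs.comp ?_).sub (hΦs.comp ?_) <;> fun_prop
  have hK := contDiff_leibniz hJ
  have heq : D = fun p : ℝ × ℝ => (1 / 2 : ℝ) * ∫ s in (0 : ℝ)..p.1, J (s, p) := by
    funext p
    rw [show p = (p.1, p.2) from rfl, hD]
  rw [heq, fderiv_const_mul ((hK.differentiable (by simp)) (t, x))]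
  simp only [smul_apply, smul_eq_mul]
  rw [fderiv_leibniz hJ (t, x) v]
  -- the boundary term vanishes: `J (t, (t, x)) = Φ (t, x) - Φ (t, x) = 0`
  have hJ0 : J (t, (t, x)) = 0 := by simp [hJdef]
  rw [show ((t, x) : ℝ × ℝ).1 = t from rfl, hJ0, mul_zero, zero_add]
  congr 1
  refine intervalIntegral.integral_congr fun s _ => ?_
  -- `∂J(s, p)(0, v)` through the slice `p ↦ J (s, p)`
  have hslice : fderiv ℝ J (s, (t, x)) ((0 : ℝ), v) = fderiv ℝ (fun p : ℝ × ℝ => J (s, p)) (t, x) v := by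
    rw [(hasFDerivAt_slice_snd' (hJ.differentiable (by simp)) s (t, x)).fderiv]
    rfl
  rw [hslice]
  have hp := (hasFDerivAt_primitive_comp_affine hF hΦ s 1 (t, x)).sub
    (hasFDerivAt_primitive_comp_affine hF hΦ s (-1) (t, x))
  have hfun : (fun p : ℝ × ℝ => J (s, p))
      = fun q : ℝ × ℝ => Φ (s, q.2 + 1 * (q.1 - s)) - Φ (s, q.2 + -1 * (q.1 - s)) := by
    funext q
    simp only [hJdef, one_mul, neg_one_mul]
    ring_nf
  have hp' : HasFDerivAt (fun p : ℝ × ℝ => J (s, p))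
      (F (s, (t, x).2 + 1 * ((t, x).1 - s))
          • (ContinuousLinearMap.snd ℝ ℝ ℝ + (1 : ℝ) • ContinuousLinearMap.fst ℝ ℝ ℝ)
        - F (s, (t, x).2 + -1 * ((t, x).1 - s))
          • (ContinuousLinearMap.snd ℝ ℝ ℝ + (-1 : ℝ) • ContinuousLinearMap.fst ℝ ℝ ℝ)) (t, x) := by
    rw [hfun]
    exact hp
  rw [hp'.fderiv]
  simp only [sub_apply, smul_apply,
    add_apply, ContinuousLinearMap.coe_snd', ContinuousLinearMap.coe_fst',
    smul_eq_mul, one_mul, neg_one_mul]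
  ring_nf

end DuhamelOp

section DuhamelOp2

variable {F Φ D : ℝ × ℝ → ℝ}

/-- Chain rule along the characteristic reparametrisation `p ↦ (s, p.2 + c (p.1 − s))` for a
differentiable `G : ℝ × ℝ → ℝ`. -/
theorem hasFDerivAt_comp_affine {G : ℝ × ℝ → ℝ} (hG : Differentiable ℝ G) (s c : ℝ) (p : ℝ × ℝ) :
    HasFDerivAt (fun q : ℝ × ℝ => G (s, q.2 + c * (q.1 - s)))
      (fderiv ℝ G (s, p.2 + c * (p.1 - s)) (0, 1)
        • (ContinuousLinearMap.snd ℝ ℝ ℝ + c • ContinuousLinearMap.fst ℝ ℝ ℝ)) p := by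
  have hg : HasFDerivAt (fun q : ℝ × ℝ => q.2 + c * (q.1 - s))
      (ContinuousLinearMap.snd ℝ ℝ ℝ + c • ContinuousLinearMap.fst ℝ ℝ ℝ) p := by
    have h := ((ContinuousLinearMap.snd ℝ ℝ ℝ + c • ContinuousLinearMap.fst ℝ ℝ ℝ).hasFDerivAt
      (x := p)).sub_const (c * s)
    refine h.congr_of_eventuallyEq (Eventually.of_forall fun q => ?_)
    simp only [add_apply, ContinuousLinearMap.coe_snd', smul_apply, ContinuousLinearMap.coe_fst',
      smul_eq_mul]
    ring
  exact (hasDerivAt_slice_snd hG s (p.2 + c * (p.1 - s))).comp_hasFDerivAt p hg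

/-- The one-sided Duhamel integrals `A± (t, x) = ∫ s in 0..t, F (s, x ± (t − s))` are smooth. -/
theorem contDiff_duhamel_side (hF : ContDiff ℝ ∞ F) (c : ℝ) {A : ℝ × ℝ → ℝ}
    (hA : ∀ t x, A (t, x) = ∫ s in (0 : ℝ)..t, F (s, x + c * (t - s))) : ContDiff ℝ ∞ A := by
  have hJ : ContDiff ℝ ∞ fun r : ℝ × (ℝ × ℝ) => F (r.1, r.2.2 + c * (r.2.1 - r.1)) := by
    refine hF.comp ?_
    fun_prop
  have heq : A = fun p : ℝ × ℝ => ∫ s in (0 : ℝ)..p.1,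
      (fun r : ℝ × (ℝ × ℝ) => F (r.1, r.2.2 + c * (r.2.1 - r.1))) (s, p) := by
    funext p
    rw [show p = (p.1, p.2) from rfl, hA]
  rw [heq]
  exact contDiff_leibniz hJ

/-- Derivatives of the one-sided Duhamel integrals:
`∂A±(t,x)(v) = v₁ F (t, x) + ∫ s in 0..t, ∂₂F (s, x ± (t−s)) (v₂ ± v₁)`. -/
theorem fderiv_duhamel_side (hF : ContDiff ℝ ∞ F) (c : ℝ) {A : ℝ × ℝ → ℝ}
    (hA : ∀ t x, A (t, x) = ∫ s in (0 : ℝ)..t, F (s, x + c * (t - s))) (t x : ℝ) (v : ℝ × ℝ) :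
    fderiv ℝ A (t, x) v = v.1 * F (t, x)
      + (v.2 + c * v.1) * ∫ s in (0 : ℝ)..t, fderiv ℝ F (s, x + c * (t - s)) (0, 1) := by
  set J : ℝ × (ℝ × ℝ) → ℝ := fun r => F (r.1, r.2.2 + c * (r.2.1 - r.1)) with hJdef
  have hJ : ContDiff ℝ ∞ J := by
    refine hF.comp ?_
    fun_prop
  have heq : A = fun p : ℝ × ℝ => ∫ s in (0 : ℝ)..p.1, J (s, p) := by
    funext p
    rw [show p = (p.1, p.2) from rfl, hA]
  rw [heq, fderiv_leibniz hJ (t, x) v]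
  have hJt : J (t, (t, x)) = F (t, x) := by simp [hJdef]
  rw [show ((t, x) : ℝ × ℝ).1 = t from rfl, hJt]
  congr 1
  rw [mul_comm, ← intervalIntegral.integral_mul_const]
  refine intervalIntegral.integral_congr fun s _ => ?_
  have hslice : fderiv ℝ J (s, (t, x)) ((0 : ℝ), v) = fderiv ℝ (fun p : ℝ × ℝ => J (s, p)) (t, x) v := by
    rw [(hasFDerivAt_slice_snd' (hJ.differentiable (by simp)) s (t, x)).fderiv]
    rfl
  rw [hslice]
  have hp : HasFDerivAt (fun p : ℝ × ℝ => J (s, p))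
      (fderiv ℝ F (s, (t, x).2 + c * ((t, x).1 - s)) (0, 1)
        • (ContinuousLinearMap.snd ℝ ℝ ℝ + c • ContinuousLinearMap.fst ℝ ℝ ℝ)) (t, x) :=
    hasFDerivAt_comp_affine (hF.differentiable (by simp)) s c (t, x)
  rw [hp.fderiv]
  simp only [smul_apply, add_apply, ContinuousLinearMap.coe_snd', ContinuousLinearMap.coe_fst',
    smul_eq_mul]

/-- **The Duhamel operator solves the inhomogeneous wave equation**: with `Φ`, `D` as in
`contDiff_duhamel`, `D_tt − D_xx = F` everywhere (second partials as `∂²D(z)(1,0)(1,0)`,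
`∂²D(z)(0,1)(0,1)`), and `D (0, ·) = 0`, `D_t (0, ·) = 0`. [folklore] -/
theorem duhamel_wave_eq (hF : ContDiff ℝ ∞ F) (hΦ : ∀ s z, Φ (s, z) = ∫ y in (0 : ℝ)..z, F (s, y))
    (hD : ∀ t x, D (t, x) = (1 / 2) * ∫ s in (0 : ℝ)..t, (Φ (s, x + (t - s)) - Φ (s, x - (t - s))))
    (z : ℝ × ℝ) :
    fderiv ℝ (fderiv ℝ D) z (1, 0) (1, 0) - fderiv ℝ (fderiv ℝ D) z (0, 1) (0, 1) = F z := by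
  obtain ⟨t, x⟩ := z
  have hDs := contDiff_duhamel hF hΦ hD
  have hD2 : ContDiff ℝ 2 D := hDs.of_le (by norm_cast)
  have hFc' : Continuous F := hF.continuous
  -- the one-sided integrals
  set A : ℝ × ℝ → ℝ := fun p => ∫ s in (0 : ℝ)..p.1, F (s, p.2 + 1 * (p.1 - s)) with hAdef
  set B : ℝ × ℝ → ℝ := fun p => ∫ s in (0 : ℝ)..p.1, F (s, p.2 + (-1) * (p.1 - s)) with hBdef
  have hA : ∀ t x, A (t, x) = ∫ s in (0 : ℝ)..t, F (s, x + 1 * (t - s)) := fun _ _ => rfl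
  have hB : ∀ t x, B (t, x) = ∫ s in (0 : ℝ)..t, F (s, x + (-1) * (t - s)) := fun _ _ => rfl
  have hAs := contDiff_duhamel_side hF 1 hA
  have hBs := contDiff_duhamel_side hF (-1) hB
  have hAd := hAs.differentiable (by simp)
  have hBd := hBs.differentiable (by simp)
  have hi : ∀ (c t' x' : ℝ), IntervalIntegrable (fun s => F (s, x' + c * (t' - s))) volume 0 t' :=
    fun c t' x' => (Continuous.intervalIntegrable (by fun_prop) _ _)
  -- first partials of `D` as functions
  have hDt : (fun z => fderiv ℝ D z (1, 0)) = fun z => (1 / 2 : ℝ) * (A z + B z) := by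
    funext z
    obtain ⟨t', x'⟩ := z
    rw [fderiv_duhamel hF hΦ hD t' x' (1, 0), hAdef, hBdef]
    simp only
    rw [← intervalIntegral.integral_add (hi 1 t' x') (hi (-1) t' x')]
    congr 1
    refine intervalIntegral.integral_congr fun s _ => ?_
    simp only [one_mul, neg_one_mul]
    ring_nf
  have hDx : (fun z => fderiv ℝ D z (0, 1)) = fun z => (1 / 2 : ℝ) * (A z - B z) := by
    funext z
    obtain ⟨t', x'⟩ := z
    rw [fderiv_duhamel hF hΦ hD t' x' (0, 1), hAdef, hBdef]
    simp only
    rw [← intervalIntegral.integral_sub (hi 1 t' x') (hi (-1) t' x')]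
    congr 1
    refine intervalIntegral.integral_congr fun s _ => ?_
    simp only [one_mul, neg_one_mul]
    ring_nf
  -- second partials
  rw [← fderiv_fderiv_apply hD2 (t, x) (1, 0) (1, 0), ← fderiv_fderiv_apply hD2 (t, x) (0, 1) (0, 1),
    hDt, hDx]
  have hsum : DifferentiableAt ℝ (fun z => A z + B z) (t, x) := (hAd (t, x)).add (hBd (t, x))
  have hdif : DifferentiableAt ℝ (fun z => A z - B z) (t, x) := (hAd (t, x)).sub (hBd (t, x))
  have e1 : fderiv ℝ (fun z => (1 / 2 : ℝ) * (A z + B z)) (t, x)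
      = (1 / 2 : ℝ) • (fderiv ℝ A (t, x) + fderiv ℝ B (t, x)) := by
    rw [fderiv_const_mul hsum, fderiv_fun_add (hAd _) (hBd _)]
  have e2 : fderiv ℝ (fun z => (1 / 2 : ℝ) * (A z - B z)) (t, x)
      = (1 / 2 : ℝ) • (fderiv ℝ A (t, x) - fderiv ℝ B (t, x)) := by
    rw [fderiv_const_mul hdif, fderiv_fun_sub (hAd _) (hBd _)]
  rw [e1, e2]
  simp only [smul_apply, add_apply, sub_apply, smul_eq_mul]
  rw [fderiv_duhamel_side hF 1 hA t x (1, 0), fderiv_duhamel_side hF (-1) hB t x (1, 0),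
    fderiv_duhamel_side hF 1 hA t x (0, 1), fderiv_duhamel_side hF (-1) hB t x (0, 1)]
  ring

/-- Initial data of the Duhamel operator: `D (0, x) = 0`. -/
theorem duhamel_zero (hD : ∀ t x, D (t, x) = (1 / 2) * ∫ s in (0 : ℝ)..t, (Φ (s, x + (t - s)) - Φ (s, x - (t - s))))
    (x : ℝ) : D (0, x) = 0 := by
  rw [hD]
  simp

/-- Initial data of the Duhamel operator: `D_t (0, x) = 0`. -/
theorem fderiv_duhamel_zero (hF : ContDiff ℝ ∞ F)
    (hΦ : ∀ s z, Φ (s, z) = ∫ y in (0 : ℝ)..z, F (s, y))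
    (hD : ∀ t x, D (t, x) = (1 / 2) * ∫ s in (0 : ℝ)..t, (Φ (s, x + (t - s)) - Φ (s, x - (t - s))))
    (x : ℝ) : fderiv ℝ D (0, x) (1, 0) = 0 := by
  rw [fderiv_duhamel hF hΦ hD 0 x (1, 0)]
  simp

end DuhamelOp2

end WaveEnergy

end

end Summit.FinalStateConjecture.FinalStateConjecture.Theorems
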